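import Literature.AnabelianGeometry.AbsoluteAnabelian.ArchimedeanHolFieldFunctorGeometricOverIdRigid
import HarnessLib

/-!
# Id-rigidity descends along epimorphic covers from a full subcategory ([AbsTopIII] §0, Prop. 4.2 (i))

S. Mochizuki, *Topics in Absolute Anabelian Geometry III*, §0 p. 27 (rigid functors, id-rigid categories)
and the proof of Prop. 4.2 (i), kurims p. 106 l. 11–19: the id-rigidity of «the full subcategory of `EA`
consisting of objects that map to `X`» is obtained from the (slimness-driven) triviality of compatible
automorphisms of the finite étale COVERINGS of `X`, and then propagated DOWN the covering maps.
[cite: MochizukiAbsTopIII2015, Proposition 4.2 (i) p.106]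

PROOF-ONLY toolkit (abc-iut cell, seat abc-iut-w6-d003 gen 4; campaign-L R1, GAP row G-L4t14-R1; written
after the audit finding VACUITY-H1 on `ArchimedeanHolFieldFunctorGeometricOverIdRigidTorus.lean`, p438544):
the cell's decomposition `isIdRigid_mapsTo_of_over` derives `α_X = 𝟙` from the hypothesis (H1) «an
automorphism of `X` commuting with `End X` is trivial», which FAILS whenever `Z(Aut X) ≠ 1` (every
once-punctured elliptic curve, generic four-punctured spheres, …).  Print instead kills `α` on the COVERS of
`X` and pushes the triviality down along the (epimorphic) covering maps.  The abstract form of that step: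

* `isIdRigid_fullSubcategory_of_epi_cover` — if `P ≤ Q` are properties of objects of `C`, the full
  subcategory on `P` is id-rigid, and every `Q`-object receives an EPIMORPHISM (of `C`) from some
  `P`-object, then the full subcategory on `Q` is id-rigid;
* `isIdRigid_mapsTo_of_epi_cover` — the case `Q := (Nonempty (· ⟶ X))` («objects mapping to `X`»): it is
  id-rigid as soon as some family `P` of objects over `X` (e.g. the Galois coverings of `X`), closed under
  nothing in particular, spans an id-rigid full subcategory and covers every object over `X` by an
  epimorphism.  No hypothesis on `End X` or `Aut X`.
* `isIdRigid_mapsTo_of_app_self_eq_id` — abc-iut-L4-t14's `isIdRigid_mapsTo_of_over` with (H1) replaced by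
  exactly what its proof uses, (H1⁎) «every automorphism `α` of `𝟭_{mapsTo X}` has `α_X = 𝟙`», plus (H2)
  the id-rigidity of the slice `Over X`.  (H1⁎) is the shape delivered by the group-theoretic criterion of
  abc-iut-L6-t18's `exists_eq_conj_of_twisted_natural` (p440184: a natural family twisted by `θ = (α_X)_*`
  forces `θ` inner) composed with «`Aut(X) → Out(π̂₁(X^top))` is injective» — the honest (H1′).

So the honest per-object residual of the `EA` column becomes (T) «the full subcategory of `EA` on the
Galois finite étale coverings of `X` is id-rigid» (true for hyperbolic `X` by the slimness of the
fundamental group of the core, [AbsTopIII] Lemma 4.3) plus (E) «every `Y → X` is dominated by a Galois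
covering» (Galois closure), instead of the false-in-general (H1).  Elementary category theory over
Mathlib; no definition, no instance; nothing here bears on [IUTchIII] Cor. 3.12.
-/

namespace Literature.AnabelianGeometry.AbsoluteAnabelian

open _root_.CategoryTheory

universe v u

variable {C : Type u} [Category.{v} C]

/-- The components of an automorphism of the identity functor of a full subcategory vanish on an
id-rigid SMALLER full subcategory (restriction along the fully faithful inclusion `ιOfLE`).
[cite: MochizukiAbsTopIII2015, Section 0 p.27] -/
theorem hom_app_eq_id_of_le {P Q : ObjectProperty C} (hPQ : P ≤ Q) (hP : IsIdRigid P.FullSubcategory)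
    (α : 𝟭 Q.FullSubcategory ≅ 𝟭 Q.FullSubcategory) (Z : C) (hZ : P Z) :
    (α.hom.app ⟨Z, hPQ Z hZ⟩).hom = 𝟙 Z := by
  -- restrict `α` to `P.FullSubcategory` through the fully faithful inclusion
  let ι : P.FullSubcategory ⥤ Q.FullSubcategory := ObjectProperty.ιOfLE hPQ
  let β : 𝟭 P.FullSubcategory ≅ 𝟭 P.FullSubcategory :=
    NatIso.ofComponents (fun z => ι.preimageIso (α.app (ι.obj z))) (fun {z z'} g => ι.map_injective (by
      simp only [Functor.id_obj, Functor.id_map, Functor.map_comp, Functor.preimageIso_hom,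
        Functor.map_preimage, Iso.app_hom]
      exact α.hom.naturality (ι.map g)))
  have hβ := hP.hom_app_eq_id β ⟨Z, hZ⟩
  have h := congrArg (fun k => (ι.map k).hom) hβ
  simp only [β, NatIso.ofComponents_hom_app, Functor.preimageIso_hom, Functor.map_preimage,
    Iso.app_hom, Functor.id_obj] at h
  exact h

/-- **Id-rigidity descends along epimorphic covers from a full subcategory.**  Let `P ≤ Q` be
properties of objects of `C`.  If the full subcategory on `P` is id-rigid and every object satisfying
`Q` is the target of an epimorphism of `C` whose source satisfies `P`, then the full subcategory on `Q`
is id-rigid: for an automorphism `α` of `𝟭_Q`, `α_Z = 𝟙` on `P`-objects (restriction to the id-rigid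
`P`), and for `f : Z ↠ Y` naturality `f ≫ α_Y = α_Z ≫ f = f` gives `α_Y = 𝟙` by cancelling the epi.
This is the «push down along the coverings» step of the proof of [AbsTopIII] Prop. 4.2 (i).
[cite: MochizukiAbsTopIII2015, Proposition 4.2 (i) p.106] -/
theorem isIdRigid_fullSubcategory_of_epi_cover {P Q : ObjectProperty C} (hPQ : P ≤ Q)
    (hP : IsIdRigid P.FullSubcategory)
    (hcov : ∀ Y : C, Q Y → ∃ (Z : C) (_ : P Z) (f : Z ⟶ Y), Epi f) :
    IsIdRigid Q.FullSubcategory := by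
  refine isRigidFunctor_of_hom_app_eq_id fun α Y => ?_
  obtain ⟨Z, hZ, f, hf⟩ := hcov Y.obj Y.property
  have hZ1 := hom_app_eq_id_of_le hPQ hP α Z hZ
  -- naturality of `α` along `f : Z ⟶ Y` inside `Q.FullSubcategory`
  have hnat := α.hom.naturality (X := ⟨Z, hPQ Z hZ⟩) (Y := Y) (ObjectProperty.homMk f)
  have h' := congrArg InducedCategory.Hom.hom hnat
  simp only [Functor.id_obj, Functor.id_map, ObjectProperty.FullSubcategory.comp_hom,
    ObjectProperty.homMk_hom, hZ1, Category.id_comp] at h'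
  -- `f ≫ α_Y = f`, cancel the epimorphism `f`
  apply ObjectProperty.hom_ext
  have h'' : f ≫ (α.hom.app Y).hom = f ≫ 𝟙 Y.obj := by rw [Category.comp_id]; exact h'
  exact (cancel_epi f).1 h''

/-- **«Objects mapping to `X`» is id-rigid from an id-rigid epimorphically covering family over `X`.**
For any property `P` of objects of `C` such that every `P`-object maps to `X`, the full subcategory on `P`
is id-rigid, and every object mapping to `X` receives an epimorphism from a `P`-object, the full
subcategory `{Y | Nonempty (Y ⟶ X)}` is id-rigid.  Typical `P`: the Galois finite étale coverings of `X`
(epimorphic images = all connected coverings, by Galois closure); the id-rigidity of THAT full subcategory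
is where the slimness of [AbsTopIII] Lemma 4.3 enters.  NO hypothesis on `End X` / `Aut X` (compare the
cell's `isIdRigid_mapsTo_of_over`, whose (H1) fails when `Z(Aut X) ≠ 1`).
[cite: MochizukiAbsTopIII2015, Proposition 4.2 (i) p.106] -/
theorem isIdRigid_mapsTo_of_epi_cover (X : C) {P : ObjectProperty C}
    (hPX : ∀ Z : C, P Z → Nonempty (Z ⟶ X)) (hP : IsIdRigid P.FullSubcategory)
    (hcov : ∀ Y : C, Nonempty (Y ⟶ X) → ∃ (Z : C) (_ : P Z) (f : Z ⟶ Y), Epi f) :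
    IsIdRigid (ObjectProperty.FullSubcategory fun Y : C => Nonempty (Y ⟶ X)) :=
  isIdRigid_fullSubcategory_of_epi_cover (P := P) (Q := fun Y : C => Nonempty (Y ⟶ X)) hPX hP hcov

/-! ### The slice route with (H1) replaced by its conclusion -/

/-- **«Objects mapping to `X`» is id-rigid from (H1⁎) + (H2).**  (H1⁎): every automorphism `α` of the
identity functor of `{Y | Nonempty (Y ⟶ X)}` has trivial component at `X` (`α_X = 𝟙`); (H2): the slice
`Over X` is id-rigid.  This is abc-iut-L4-t14's `isIdRigid_mapsTo_of_over` with its hypothesis (H1) («an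
automorphism of `X` commuting with `End X` is trivial» — FALSE whenever `Z(Aut X) ≠ 1`, e.g. at every
once-punctured elliptic curve) weakened to exactly what the proof consumes; same slice argument
(`app_over`: once `α_X = 𝟙`, every `α_Y` is a morphism over `X`, and `Y/X ↦ α_Y` is an automorphism of
`𝟭_{Over X}`).  (H1⁎) is what «`(α_X)_*` inner on `π̂₁` (twisted natural families, p440184) + `Aut(X) ↪
Out(π̂₁(X^top))`» delivers. [cite: MochizukiAbsTopIII2015, Proposition 4.2 (i) p.106] -/
theorem isIdRigid_mapsTo_of_app_self_eq_id (X : C)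
    (h1 : ∀ α : 𝟭 (ObjectProperty.FullSubcategory fun Y : C => Nonempty (Y ⟶ X)) ≅ 𝟭 _,
      (α.hom.app (mapsToSelf X)).hom = 𝟙 X)
    (h2 : IsIdRigid (Over X)) :
    IsIdRigid (ObjectProperty.FullSubcategory fun Y : C => Nonempty (Y ⟶ X)) := by
  refine isRigidFunctor_of_hom_app_eq_id fun α Y => ?_
  have hX : (α.hom.app (mapsToSelf X)).hom = 𝟙 X := h1 α
  -- the restriction of `α` to the slice (verbatim the construction of `isIdRigid_mapsTo_of_over`)
  let β : 𝟭 (Over X) ≅ 𝟭 (Over X) :=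
    NatIso.ofComponents
      (fun B => Over.isoMk ((ObjectProperty.ι _).mapIso (α.app ⟨B.left, ⟨B.hom⟩⟩))
        (app_over X α hX B.hom))
      (fun {B B'} g => by
        ext
        have h := α.hom.naturality (X := ⟨B.left, ⟨B.hom⟩⟩) (Y := ⟨B'.left, ⟨B'.hom⟩⟩)
          (ObjectProperty.homMk g.left)
        have h' := congrArg InducedCategory.Hom.hom h
        simp only [Functor.id_obj, Functor.id_map, ObjectProperty.FullSubcategory.comp_hom,
          ObjectProperty.homMk_hom] at h'
        simpa using h')
  obtain ⟨f⟩ := Y.property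
  have hB : β.hom.app (Over.mk f) = 𝟙 _ := h2.hom_app_eq_id β (Over.mk f)
  have hB' : (α.hom.app ⟨Y.obj, ⟨f⟩⟩).hom = 𝟙 Y.obj := by
    have h := congrArg (fun k => Over.Hom.left k) hB
    simp only [β, NatIso.ofComponents_hom_app, Over.isoMk_hom_left, Functor.mapIso_hom,
      ObjectProperty.ι_map, Iso.app_hom, Functor.id_obj, Over.id_left] at h
    exact h
  apply ObjectProperty.hom_ext
  exact hB'

/-- Conversely (sanity): (H1) implies (H1⁎) — so `isIdRigid_mapsTo_of_app_self_eq_id` GENERALISES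
`isIdRigid_mapsTo_of_over` (the `X`-component of `α` commutes with `End X` by naturality, `app_self_comm`).
[cite: MochizukiAbsTopIII2015, Section 0 p.27] -/
theorem app_self_eq_id_of_H1 (X : C)
    (h1 : ∀ a : X ≅ X, (∀ u : X ⟶ X, a.hom ≫ u = u ≫ a.hom) → a.hom = 𝟙 X)
    (α : 𝟭 (ObjectProperty.FullSubcategory fun Y : C => Nonempty (Y ⟶ X)) ≅ 𝟭 _) :
    (α.hom.app (mapsToSelf X)).hom = 𝟙 X :=
  h1 ((ObjectProperty.ι _).mapIso (α.app (mapsToSelf X))) (app_self_comm X α)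

/-- The degenerate case `P = Q`: trivially, an id-rigid full subcategory is id-rigid (sanity check of
the binder shapes; `f := 𝟙`). [cite: MochizukiAbsTopIII2015, Section 0 p.27] -/
theorem isIdRigid_fullSubcategory_of_epi_cover_self {P : ObjectProperty C}
    (hP : IsIdRigid P.FullSubcategory) : IsIdRigid P.FullSubcategory :=
  isIdRigid_fullSubcategory_of_epi_cover (P := P) (Q := P) le_rfl hP
    fun Y hY => ⟨Y, hY, 𝟙 Y, inferInstance⟩

end Literature.AnabelianGeometry.AbsoluteAnabelian
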